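import Summits.Ventures.PercRepro.RankLevelSetRuleQNoFiveUp
import Summits.Ventures.PercRepro.RankLevelSetRuleQCellSixFalse
import Summits.Ventures.PercRepro.RankLevelSetRuleQModelRecv

/-!
# PercRepro — RULE Q FAILS ON AN EXPLICIT MATROID OF EVERY CELL FAMILY `k ≥ 5` (night-1, gen 16; dossier §27.10)

The matroid-level form of RankLevelSetRuleQNoFiveUp / CellFiveFalse / CellSixFalse: through the landed model identity
`modelRecvEq` (RankLevelSetRuleQModelRecv — on `T_{q+k}(U_{q,q+m} ⊕ free)` a `q`-subset of the flat receives exactly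
`R̂(q, k, m)` under Rule Q's equal split), every arithmetic failure `R̂(q, k, q−2) < Φ(q+k, q)` is a finite matroid at the tight
layer `#E = (q+k) + q` on which `RuleQUp` fails — exactly as the cell's single witness `not_ruleQUp_model` at `(86, 72)`.
* `rhat_lt_phiK_of_five_le` — the slice inequality `R̂(m+2, k, m) < Φ(m+2+k, m+2)` for `k ≥ 5`, `m ≥ 4^{k+3}` (the body of
  `not_rhatCell_of_five_le`, exposed);
* **`not_ruleQUp_of_five_le`** — for every `k ≥ 5` and `q ≥ 4^{k+3} + 2` an explicit finite matroid with `#E = (q+k) + q` and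
  `¬ RuleQUp M (q+k) q`; **`not_ruleQUp_five`** / **`not_ruleQUp_six`** — the same for `k = 5, 6` and every `q ≥ 1002`.
With p4's `ruleQUp_of_le_four` (Rule Q pays every member on every cell of the families `k ≤ 4`), Rule Q's equal split is a
universal mechanism of the UP form on the cell families `k` if and only if `k ≤ 4`. Axioms: standard.
-/

namespace PercRepro

open Finset

set_option maxHeartbeats 400000 in
/-- **The slice inequality for every `k ≥ 5`**: `R̂(m+2, k, m) < Φ(m+2+k, m+2)` for `m ≥ 4^{k+3}` (the body of
`not_rhatCell_of_five_le`). -/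
theorem rhat_lt_phiK_of_five_le (k : ℕ) (hk : 5 ≤ k) (m : ℕ) (hm : 4 ^ (k + 3) ≤ m) :
    rhat (m + 2) k m < phiK (m + 2 + k) (m + 2) := by
  have h4 : 0 < 4 ^ (k + 3) := by positivity
  have hm1 : 1 ≤ m := by omega
  have hphi := phiK_ge_sub_one (m + 2) k (by omega)
  have hup := rhat_le_uniform k m (by omega)
  rw [cellTwo_sum_eq m 1, slice_two_S2_eq m hm1, slice_T_eq m hm1] at hup
  push_cast at hup
  -- closed forms: S₁ = ((m+1) − ρ)/(2m+3), S₂ = (1 + 2ρ)/(2(2m+3)), ρ = X(m+2)/(2m+1) − 1 − (m+2)/(2(m+1))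
  set C := ((m + 1 + 1 + m).choose m : ℚ) with hC
  set P := ∑ i ∈ range m, ((m + 1 + 1 + m).choose i : ℚ) with hPdef
  set C0 := ((2 * m).choose m : ℚ) with hC0
  set X := (4 : ℚ) ^ m / C0 with hXdef
  have hCpos : (0 : ℚ) < C := by rw [hC]; exact_mod_cast Nat.choose_pos (by omega)
  have hC0pos : (0 : ℚ) < C0 := by rw [hC0]; exact_mod_cast Nat.choose_pos (by omega)
  have hX0 : (0 : ℚ) ≤ X := by positivity
  have hrho : P / C = X * ((m : ℚ) + 2) / (2 * (m : ℚ) + 1) - 1 - ((m : ℚ) + 2) / (2 * ((m : ℚ) + 1)) :=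
    slice_two_rho_eq m hm1
  have e1 : (((m : ℚ) + 1) * C - 1 * P) / (C * ((m : ℚ) + 1 + 1 + m + 1))
      = (((m : ℚ) + 1) - P / C) / (2 * (m : ℚ) + 3) := by field_simp; ring
  have e2 : (C + 2 * P) / (2 * C * (2 * (m : ℚ) + 3)) = (1 + 2 * (P / C)) / (2 * (2 * (m : ℚ) + 3)) := by
    field_simp
  rw [e1, e2, hrho] at hup
  -- the three elementary bounds
  have hS1 : (((m : ℚ) + 1) - (X * ((m : ℚ) + 2) / (2 * (m : ℚ) + 1) - 1 - ((m : ℚ) + 2) / (2 * ((m : ℚ) + 1))))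
      / (2 * (m : ℚ) + 3) ≤ 1 / 2 := by
    rw [div_le_iff₀ (by positivity)]
    have hrho0 : (0 : ℚ) ≤ X * ((m : ℚ) + 2) / (2 * (m : ℚ) + 1) - 1 - ((m : ℚ) + 2) / (2 * ((m : ℚ) + 1)) := by
      rw [← hrho]; positivity
    linarith [hrho0]
  have hS2 : (1 + 2 * (X * ((m : ℚ) + 2) / (2 * (m : ℚ) + 1) - 1 - ((m : ℚ) + 2) / (2 * ((m : ℚ) + 1))))
      / (2 * (2 * (m : ℚ) + 3)) ≤ (1 + 2 * X) / (4 * (m : ℚ)) := by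
    have hr : X * ((m : ℚ) + 2) / (2 * (m : ℚ) + 1) - 1 - ((m : ℚ) + 2) / (2 * ((m : ℚ) + 1)) ≤ X := by
      have : X * ((m : ℚ) + 2) / (2 * (m : ℚ) + 1) ≤ X := by
        rw [div_le_iff₀ (by positivity)]
        have hm1' : (1 : ℚ) ≤ m := by exact_mod_cast hm1
        nlinarith [hX0, hm1']
      have : (0 : ℚ) ≤ 1 + ((m : ℚ) + 2) / (2 * ((m : ℚ) + 1)) := by positivity
      linarith
    rw [div_le_div_iff₀ (by positivity) (by positivity)]
    nlinarith [hr, hX0]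
  have hT : 1 / (2 * (m : ℚ) + 2) + X / (2 * (2 * (m : ℚ) + 1)) ≤ (2 + X) / (4 * (m : ℚ)) := by
    have hm1' : (1 : ℚ) ≤ m := by exact_mod_cast hm1
    have ha : 1 / (2 * (m : ℚ) + 2) ≤ 2 / (4 * (m : ℚ)) := by
      rw [div_le_div_iff₀ (by positivity) (by positivity)]; nlinarith
    have hb : X / (2 * (2 * (m : ℚ) + 1)) ≤ X / (4 * (m : ℚ)) := by
      apply div_le_div_of_nonneg_left hX0 (by positivity) (by linarith)
    calc 1 / (2 * (m : ℚ) + 2) + X / (2 * (2 * (m : ℚ) + 1)) ≤ 2 / (4 * (m : ℚ)) + X / (4 * (m : ℚ)) := add_le_add ha hb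
      _ = (2 + X) / (4 * (m : ℚ)) := by ring
  -- the coefficients and the Wallis bound
  have hcoef := sum_choose_div_choose_two_le k (by omega)
  have hc2 : ((k + 2).choose 2 : ℚ) = ((k : ℚ) + 2) * ((k : ℚ) + 1) / 2 := by
    obtain ⟨c2, -, -, -⟩ := choose_small_values k
    rw [eq_div_iff (by norm_num)]; exact c2
  have hW := centralBinom_sq_mul_ge m (by omega)
  rw [Nat.centralBinom_eq_two_mul_choose] at hW
  have hX2 : X ^ 2 ≤ 4 * (m : ℚ) := by
    have h16 : (16 : ℚ) ^ m = ((4 : ℚ) ^ m) ^ 2 := by rw [← pow_mul, mul_comm, pow_mul]; norm_num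
    have h' : ((16 ^ m : ℕ) : ℚ) ≤ (((2 * m).choose m ^ 2 * (4 * m) : ℕ) : ℚ) := by exact_mod_cast hW
    push_cast at h'
    have hX : (4 : ℚ) ^ m = X * C0 := by rw [hXdef]; field_simp
    rw [h16, hX] at h'
    have : (X * C0) ^ 2 = X ^ 2 * C0 ^ 2 := by ring
    rw [this] at h'
    have hC0sq : (0 : ℚ) < C0 ^ 2 := by positivity
    nlinarith [h', hC0sq]
  -- E = 2^{k+2}: (k+2)(k+1) ≤ E, 128 ≤ E, 4E² ≤ m, X·E ≤ m
  set E : ℚ := (2 : ℚ) ^ (k + 2) with hE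
  have hE1 : (128 : ℚ) ≤ E := by
    rw [hE]
    calc (128 : ℚ) = 2 ^ 7 := by norm_num
      _ ≤ 2 ^ (k + 2) := pow_le_pow_right₀ (by norm_num) (by omega)
  have hEk : ((k : ℚ) + 2) * ((k : ℚ) + 1) ≤ E := by
    rw [hE]; exact_mod_cast succ_mul_succ_le_two_pow k hk
  have hmE : 4 * E ^ 2 ≤ (m : ℚ) := by
    have : (4 : ℚ) ^ (k + 3) ≤ m := by exact_mod_cast (show 4 ^ (k + 3) ≤ m by omega)
    rw [hE]
    have h44 : (4 : ℚ) ^ (k + 3) = 4 * ((2 : ℚ) ^ (k + 2)) ^ 2 := by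
      have h4 : (4 : ℚ) = 2 ^ 2 := by norm_num
      rw [h4, ← pow_mul, ← pow_mul]
      ring
    rw [← h44]; exact this
  have hXE : X * E ≤ m := by
    -- X² ≤ 4m and 4E² ≤ m ⇒ (XE)² ≤ 4m·E² ≤ m²
    have h1 : (X * E) ^ 2 ≤ (m : ℚ) ^ 2 := by
      calc (X * E) ^ 2 = X ^ 2 * E ^ 2 := by ring
        _ ≤ 4 * (m : ℚ) * E ^ 2 := by gcongr
        _ = (m : ℚ) * (4 * E ^ 2) := by ring
        _ ≤ (m : ℚ) * m := by gcongr
        _ = (m : ℚ) ^ 2 := by ring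
    have hXE0 : 0 ≤ X * E := by positivity
    exact (pow_le_pow_iff_left₀ hXE0 (by positivity) two_ne_zero).mp h1
  have hfin := uniform_finish k m X E (by exact_mod_cast hk) hEk hE1 hmE hX0 hXE
  -- assemble: Φ ≤ rhat ≤ (k+2)S₁ + C(k+2,2)S₂ + coef·T ≤ (k+2)/2 + [...]/(4m) < k − 1 ≤ Φ
  have hcoef0 : (0 : ℚ) ≤ ∑ u ∈ Finset.range (k - 3), ((k + 2).choose (u + 3) : ℚ) / ((u + 3).choose 2 : ℚ) := by
    positivity
  have hT0 : (0 : ℚ) ≤ 1 / (2 * (m : ℚ) + 2) + X / (2 * (2 * (m : ℚ) + 1)) := by positivity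
  have hbound : ((k : ℚ) + 2) * ((((m : ℚ) + 1) - (X * ((m : ℚ) + 2) / (2 * (m : ℚ) + 1) - 1
        - ((m : ℚ) + 2) / (2 * ((m : ℚ) + 1)))) / (2 * (m : ℚ) + 3))
      + ((k + 2).choose 2 : ℚ) * ((1 + 2 * (X * ((m : ℚ) + 2) / (2 * (m : ℚ) + 1) - 1
        - ((m : ℚ) + 2) / (2 * ((m : ℚ) + 1)))) / (2 * (2 * (m : ℚ) + 3)))
      + (∑ u ∈ Finset.range (k - 3), ((k + 2).choose (u + 3) : ℚ) / ((u + 3).choose 2 : ℚ))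
        * (1 / (2 * (m : ℚ) + 2) + X / (2 * (2 * (m : ℚ) + 1)))
      ≤ ((k : ℚ) + 2) / 2 + ((((k : ℚ) + 2) * ((k : ℚ) + 1) / 2) * (1 + 2 * X) + (E / 3) * (2 + X)) / (4 * (m : ℚ)) := by
    have hk0 : (0 : ℚ) ≤ (k : ℚ) + 2 := by positivity
    have hc0 : (0 : ℚ) ≤ ((k + 2).choose 2 : ℚ) := by positivity
    have t1 := mul_le_mul_of_nonneg_left hS1 hk0
    have t2 := mul_le_mul_of_nonneg_left hS2 hc0
    have t3 : (∑ u ∈ Finset.range (k - 3), ((k + 2).choose (u + 3) : ℚ) / ((u + 3).choose 2 : ℚ))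
        * (1 / (2 * (m : ℚ) + 2) + X / (2 * (2 * (m : ℚ) + 1))) ≤ (E / 3) * ((2 + X) / (4 * (m : ℚ))) := by
      have hE3 : (∑ u ∈ Finset.range (k - 3), ((k + 2).choose (u + 3) : ℚ) / ((u + 3).choose 2 : ℚ)) ≤ E / 3 := by
        rw [hE]; exact hcoef
      calc _ ≤ (∑ u ∈ Finset.range (k - 3), ((k + 2).choose (u + 3) : ℚ) / ((u + 3).choose 2 : ℚ))
            * ((2 + X) / (4 * (m : ℚ))) := mul_le_mul_of_nonneg_left hT hcoef0
        _ ≤ (E / 3) * ((2 + X) / (4 * (m : ℚ))) := mul_le_mul_of_nonneg_right hE3 (by positivity)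
    rw [hc2] at t2 ⊢
    have : ((k : ℚ) + 2) * (1 / 2) + ((k : ℚ) + 2) * ((k : ℚ) + 1) / 2 * ((1 + 2 * X) / (4 * (m : ℚ)))
        + (E / 3) * ((2 + X) / (4 * (m : ℚ)))
        = ((k : ℚ) + 2) / 2 + ((((k : ℚ) + 2) * ((k : ℚ) + 1) / 2) * (1 + 2 * X) + (E / 3) * (2 + X)) / (4 * (m : ℚ)) := by
      field_simp
      ring
    linarith [t1, t2, t3, this]
  linarith [hphi, hup, hbound, hfin]

/-- **Rule Q fails on an explicit finite matroid at the tight layer of the cell `(q+k, q)` for every `k ≥ 5`, `q ≥ 4^{k+3} + 2`**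
(the model `T_{q+k}(U_{q,2q−2} ⊕ free)` at the member slice `u = 2`). -/
theorem not_ruleQUp_of_five_le (k : ℕ) (hk : 5 ≤ k) (q : ℕ) (hq : 4 ^ (k + 3) + 2 ≤ q) :
    ∃ (α : Type) (M : Matroid α) (hf : M.Finite), M.E.ncard = (q + k) + q ∧ ¬ @RuleQUp α M hf (q + k) q := by
  have h4 : 0 < 4 ^ (k + 3) := by positivity
  obtain ⟨m, rfl⟩ : ∃ m, q = m + 2 := ⟨q - 2, by omega⟩
  obtain ⟨α, M, hf, Z, hE, hZ, hrecv⟩ := modelRecvEq (m + 2) k m (by omega) (by omega) (by omega)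
  refine ⟨α, M, hf, hE, ?_⟩
  intro hRQ
  have h1 := hRQ Z hZ
  rw [hrecv] at h1
  exact absurd h1 (not_le.mpr (rhat_lt_phiK_of_five_le k hk m (by omega)))

/-- **Rule Q fails on an explicit finite matroid of the cell `(q+5, q)` for every `q ≥ 1002`.** -/
theorem not_ruleQUp_five (q : ℕ) (hq : 1002 ≤ q) :
    ∃ (α : Type) (M : Matroid α) (hf : M.Finite), M.E.ncard = (q + 5) + q ∧ ¬ @RuleQUp α M hf (q + 5) q := by
  obtain ⟨m, rfl⟩ : ∃ m, q = m + 2 := ⟨q - 2, by omega⟩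
  obtain ⟨α, M, hf, Z, hE, hZ, hrecv⟩ := modelRecvEq (m + 2) 5 m (by omega) (by norm_num) (by omega)
  refine ⟨α, M, hf, hE, ?_⟩
  intro hRQ
  have h1 := hRQ Z hZ
  rw [hrecv] at h1
  exact absurd h1 (not_le.mpr (rhat_five_lt_phiK m (by omega)))

/-- **Rule Q fails on an explicit finite matroid of the cell `(q+6, q)` for every `q ≥ 1002`.** -/
theorem not_ruleQUp_six (q : ℕ) (hq : 1002 ≤ q) :
    ∃ (α : Type) (M : Matroid α) (hf : M.Finite), M.E.ncard = (q + 6) + q ∧ ¬ @RuleQUp α M hf (q + 6) q := by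
  obtain ⟨m, rfl⟩ : ∃ m, q = m + 2 := ⟨q - 2, by omega⟩
  obtain ⟨α, M, hf, Z, hE, hZ, hrecv⟩ := modelRecvEq (m + 2) 6 m (by omega) (by norm_num) (by omega)
  refine ⟨α, M, hf, hE, ?_⟩
  intro hRQ
  have h1 := hRQ Z hZ
  rw [hrecv] at h1
  exact absurd h1 (not_le.mpr (rhat_six_lt_phiK m (by omega)))

end PercRepro
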